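/-
Copyright (c) 2026 the pub-hodgecm-mathlib formalisation cell (harness21).  Prover seat hodgecm-mathlib-K2Liu-p09 (g5): Track B «K2-LIT»,
hLiu418 = stmt-HodgeConjecture-24832; LEAD F0P6-plan RULINGS M-156m∕o, M-157a (4)∕m «A7 = GK COCYCLE ROAD», file B7-CB.
-/
import Summits.HodgeConjecture.HodgeConjecture.Theorems.K2LiuSiegelCocycleValues       -- ★ B7-V (+ B7-A, B7-B, B4d-1b, B4d-1∕2, B1b-2c)
import HarnessLib

/-!
# Crux `HLiu418`, road `K2_Liu`, organ A7-reg (GK cocycle road), file B7-CB: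
# THE CHAIN AFTER THE FIRST STEP — structure of `F″ = κ · 𝒜F′` for a Siegel section `F′`, and the short-root `hrel` datum of `F″`

Cell `hodgecm-mathlib`, crux item hLiu418 = `stmt-HodgeConjecture-24832`; squad K2 ∕ K2Liu; prover K2Liu-p09 (g5).  THEOREMS ONLY; lane
`--supports stmt-HodgeConjecture-24832` (count-neutral helper).  ONE FRAME (RULING M-156o (c)).
THE POINT.  In the cocycle `M_v(s) = A₂ A₁ A₂` the second operator acts on `F″ := κ · 𝒜F′`, `𝒜F′(g) = ∫_{F_v} F′(φ(w₂) φ(u_{2e₂}(ι_v(y)δ)) g) dμ_F(y)`, where `F′` is a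
Siegel section for SOME datum `(χ⁰_v, s₀)` — `(χ_v, s)` for the family itself, `(1, re s)` for its majorant `‖f_s‖` (★ B2′ `isLocalSiegelSection_norm`) — and `κ`
a scalar (`L(2s+1, χ_F)⁻¹` for the normalised family of ★ B7-S, `1` for the majorant).  From ★ B4d-1b ((N),(T) of `F′`), ★ B7-A (the operator) and ★ B7-B∕V:
* §1 `F″` is invariant under every `φ(u₋(r))` and every block letter `φ(n(X))`, and has the torus law `θ_𝒜(a,b) = χ⁰_s₀(φ t(a, σ(b)⁻¹)) · ∏_w ‖b_w‖`.
* §2 **the short-root `hrel` of `F″` at a place `w`**: `F″(φ(P_w) φ(u₋(1_w x)) g) = χ⁰_w(−1) · chiNorm_w(x)⁻¹ · |x|_w^{−(2s₀+1)} · F″(φ(P_w) φ(u₋(1_w x⁻¹)) φ(P_w) g)`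
  — the `hrel` binder of ★ B7-S∕B3 for the middle step, numerator `L_{E_w}(2s₀, χ⁰_F ∘ N)`.
* §3 split places `w₁ ≠ w₂`: the same for `F₃ := κ′ · ℬ_{w₂} F″` (invariances, `w₂`-swapped torus law) and its short-root `hrel` at `w₁` — same datum at `w₁`.
HONEST LABEL.  `HC_CM` is proved only modulo the 7 printed citations (2 remaining named inputs: hLiu418 = `stmt-HodgeConjecture-24832`,
h413 = `stmt-HodgeConjecture-24833`) until rung 0 closes.

## References
* [HarrisKudlaSweet1996] M. Harris, S. Kudla, W. J. Sweet, J. AMS 9 (1996), §1 (1.11)–(1.15), §6 (6.16).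
* [Casselman1980] W. Casselman, *The unramified principal series of p-adic groups I*, Compositio Math. 40 (1980), §3.
* [KudlaSweet1997] S. Kudla, W. J. Sweet, Israel J. Math. 98 (1997), §1.
-/

set_option autoImplicit false
set_option linter.dupNamespace false -- the mandated namespace repeats `HodgeConjecture.HodgeConjecture`

noncomputable section

open scoped Classical NNReal
open NumberField IsDedekindDomain Matrix MeasureTheory
open Literature.NumberTheory.GaloisRepresentations.IsNonarchimedeanLocalField
open Literature.NumberTheory.Automorphic Literature.NumberTheory.Automorphic.UnitaryGroup
open Literature.NumberTheory.GelbartRogawski1991.AdaptedBlocks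
open Literature.NumberTheory.GelbartRogawski1991.UnitaryDualPair.LocalSplitting
open Literature.NumberTheory.K2Lit.LocalSiegelDoubled
open Summit.HodgeConjecture.HodgeConjecture.Cruxes.HLiu418.K2LiuLocalLFactorDefs
open Summit.HodgeConjecture.HodgeConjecture.Cruxes.HLiu418.K2LiuLocalSiegelIwasawaFrame
open Summit.HodgeConjecture.HodgeConjecture.Cruxes.HLiu418.K2LiuLocalSiegelIwasawa
open Summit.HodgeConjecture.HodgeConjecture.Cruxes.HLiu418.K2LiuDoubledUTwoTwoBorelFrame
open Summit.HodgeConjecture.HodgeConjecture.Cruxes.HLiu418.K2LiuDoubledUTwoTwoWeylCocycle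
open Summit.HodgeConjecture.HodgeConjecture.Cruxes.HLiu418.K2LiuDoubledUTwoTwoLevi
open Summit.HodgeConjecture.HodgeConjecture.Cruxes.HLiu418.K2LiuDoubledUTwoTwoFrameTransport
open Summit.HodgeConjecture.HodgeConjecture.Cruxes.HLiu418.K2LiuUnipDeltaRankOneCoordinates
open Summit.HodgeConjecture.HodgeConjecture.Cruxes.HLiu418.K2LiuSiegelCocycleLetters
open Summit.HodgeConjecture.HodgeConjecture.Cruxes.HLiu418.K2LiuSiegelCocycleStageLong
open Summit.HodgeConjecture.HodgeConjecture.Cruxes.HLiu418.K2LiuSiegelCocycleStageShort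
open Summit.HodgeConjecture.HodgeConjecture.Cruxes.HLiu418.K2LiuSiegelCocycleValues

namespace Summit.HodgeConjecture.HodgeConjecture.Cruxes.HLiu418.K2LiuSiegelCocycleChainShort

variable (F : Type) [Field F] [NumberField F] (E : Type) [Field E] [NumberField E] [Algebra F E]
  [Algebra.IsQuadraticExtension F E] (c : E ≃ₐ[F] E)
  {δ : E} (hcδ : c δ = -δ) (hδ : δ ≠ 0) {d : F} (hd : δ * δ = algebraMap F E d) (v : HeightOneSpectrum (𝓞 F))
  {T₂ : Matrix (Fin 2) (Fin 2) F} (hT₂ : T₂.IsSymm) {J₂D : Matrix (Fin (2 + 2)) (Fin (2 + 2)) E} (hJ₂D : J₂D = (gramD F 2 T₂).map (algebraMap F E))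
  (D Dinv : Matrix (Fin 2) (Fin 2) F) (hDD : D * Dinv = 1) (Q : GL (Fin (2 + 2)) F)
  (hQm : (Q : Matrix (Fin (2 + 2)) (Fin (2 + 2)) F) = Matrix.reindex (e₂ 2) (e₂ 2) (Matrix.fromBlocks 1 D 1 (-D)))
  (hQ : (Q : Matrix (Fin (2 + 2)) (Fin (2 + 2)) F)ᵀ * gramD F 2 T₂ * (Q : Matrix (Fin (2 + 2)) (Fin (2 + 2)) F) = (StdForm.antidiagonal (2 + 2)).over F)
  [MeasurableSpace (v.adicCompletion F)] [BorelSpace (v.adicCompletion F)] (μF : Measure (v.adicCompletion F)) [μF.IsAddHaarMeasure]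
  (χv₀ : ∀ w : PlacesOver E v, (w.1.adicCompletion E)ˣ →* ℂˣ) (s₀ : ℂ)
  {F' : UnitaryGroup.localPi E c (2 + 2) J₂D v → ℂ} (hf : IsLocalSiegelSection F E c hcδ hδ hd v 2 hT₂ hJ₂D χv₀ s₀ F')
  (κ : ℂ) {F'' : UnitaryGroup.localPi E c (2 + 2) J₂D v → ℂ}
  (hF'' : ∀ g, F'' g = κ * ∫ y, F' (FrameTransport.frameConj F E c v (2 + 2) hJ₂D (antidiagonal_over_eq_map F E 2) Q hQ (toLocalFour F E c v (weylTwo (UnitaryGroup.LocalRing E v) (UnitaryGroup.conjLocal E c v))) *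
        FrameTransport.frameConj F E c v (2 + 2) hJ₂D (antidiagonal_over_eq_map F E 2) Q hQ (toLocalFour F E c v (uLongTwo (UnitaryGroup.LocalRing E v) (UnitaryGroup.conjLocal E c v)
          (UnitaryGroup.toLocalRing E v y * algebraMap E (UnitaryGroup.LocalRing E v) δ) (conjLocal_coord F E c hcδ v y))) * g) ∂μF)

/-! ## §1 The structure of `F″ = κ · 𝒜F′` -/

omit [BorelSpace (v.adicCompletion F)] [μF.IsAddHaarMeasure] in
include hd hT₂ hDD hQm hf hF'' in
/-- **`F″` is invariant under every Levi root letter `φ(u₋(r))`** (★ B7-A `stageLong_apply_uMinus` + ★ B4d-1b (N) for `F′`). [cite: Casselman1980, §3] -/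
theorem apply_uMinus (r : UnitaryGroup.LocalRing E v) (g : UnitaryGroup.localPi E c (2 + 2) J₂D v) :
    F'' (FrameTransport.frameConj F E c v (2 + 2) hJ₂D (antidiagonal_over_eq_map F E 2) Q hQ (toLocalFour F E c v
      (uMinus (UnitaryGroup.LocalRing E v) (UnitaryGroup.conjLocal E c v) (UnitaryGroup.conjLocal_conjLocal c v hcδ hδ) r)) * g) = F'' g := by
  rw [hF'', hF'', stageLong_apply_uMinus F E c hcδ hδ v hJ₂D Q hQ μF F' (apply_frameConj_uPlus F E c hcδ hδ hd v hT₂ hJ₂D D Dinv hDD Q hQm hQ hf)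
    (apply_frameConj_uLongOne F E c hcδ hδ hd v hT₂ hJ₂D D Dinv hDD Q hQm hQ hf) (apply_frameConj_uMinus F E c hcδ hδ hd v hT₂ hJ₂D D Dinv hDD Q hQm hQ hf)]

include hd hT₂ hDD hQm hf hF'' in
/-- **`F″` is invariant under every block letter `φ(n(X))`** (★ B7-A `stageLong_apply_nSiegelBlk`). [cite: HarrisKudlaSweet1996, §1 (1.11)] -/
theorem apply_nSiegelBlk (X : Matrix (Fin 2) (Fin 2) (UnitaryGroup.LocalRing E v)) (hX : IsSkewTwo (UnitaryGroup.LocalRing E v) (UnitaryGroup.conjLocal E c v) X)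
    (g : UnitaryGroup.localPi E c (2 + 2) J₂D v) :
    F'' (FrameTransport.frameConj F E c v (2 + 2) hJ₂D (antidiagonal_over_eq_map F E 2) Q hQ (toLocalFour F E c v
      (nSiegelBlk (UnitaryGroup.LocalRing E v) (UnitaryGroup.conjLocal E c v) hX)) * g) = F'' g := by
  rw [hF'', hF'', stageLong_apply_nSiegelBlk F E c hcδ hδ v hJ₂D Q hQ μF F' (apply_frameConj_uLongOne F E c hcδ hδ hd v hT₂ hJ₂D D Dinv hDD Q hQm hQ hf)
    (apply_frameConj_uMinus F E c hcδ hδ hd v hT₂ hJ₂D D Dinv hDD Q hQm hQ hf)]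

include hδ hF'' in
/-- **`F″` is invariant under every `φ(u_{2e₂}(x))`** (special block letter). [cite: HarrisKudlaSweet1996, §1 (1.11)] -/
theorem apply_uLongTwo (x : UnitaryGroup.LocalRing E v) (hx : UnitaryGroup.conjLocal E c v x = -x) (g : UnitaryGroup.localPi E c (2 + 2) J₂D v) :
    F'' (FrameTransport.frameConj F E c v (2 + 2) hJ₂D (antidiagonal_over_eq_map F E 2) Q hQ (toLocalFour F E c v
      (uLongTwo (UnitaryGroup.LocalRing E v) (UnitaryGroup.conjLocal E c v) x hx)) * g) = F'' g := by
  rw [hF'', hF'', stageLong_apply_uLongTwo F E c hcδ hδ v hJ₂D Q hQ μF F']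

include hd hT₂ hDD hQm hf hF'' in
/-- **the torus law of `F″`**: `F″(φ(t(a,b)) g) = χ⁰_s₀(φ t(a, σ(b)⁻¹)) · (∏_w ‖b_w‖) · F″(g)` (★ B7-A `stageLong_apply_torusElt` + ★ B4d-1b (T)).
[cite: Casselman1980, §3] [cite: HarrisKudlaSweet1996, §1 (1.15)] -/
theorem apply_torusElt (a b : (UnitaryGroup.LocalRing E v)ˣ) (g : UnitaryGroup.localPi E c (2 + 2) J₂D v) :
    F'' (FrameTransport.frameConj F E c v (2 + 2) hJ₂D (antidiagonal_over_eq_map F E 2) Q hQ (toLocalFour F E c v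
      (torusElt (UnitaryGroup.LocalRing E v) (UnitaryGroup.conjLocal E c v) (UnitaryGroup.conjLocal_conjLocal c v hcδ hδ) a b)) * g) =
      localSiegelCharacter F E c v 2 χv₀ s₀ (FrameTransport.frameConj F E c v (2 + 2) hJ₂D (antidiagonal_over_eq_map F E 2) Q hQ (toLocalFour F E c v
          (torusElt (UnitaryGroup.LocalRing E v) (UnitaryGroup.conjLocal E c v) (UnitaryGroup.conjLocal_conjLocal c v hcδ hδ) a
            (Units.map (UnitaryGroup.conjLocal E c v : UnitaryGroup.LocalRing E v →* UnitaryGroup.LocalRing E v) b⁻¹)))) *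
        ((∏ w : PlacesOver E v, ‖(b : UnitaryGroup.LocalRing E v) w‖ : ℝ) : ℂ) * F'' g := by
  rw [hF'', hF'', stageLong_apply_torusElt F E c hcδ hδ v hJ₂D Q hQ μF F' _ (apply_frameConj_torusElt F E c hcδ hδ hd v hT₂ hJ₂D D Dinv hDD Q hQm hQ χv₀ s₀ hf)]
  ring

/-! ## §2 The short-root `hrel` datum of `F″` at a place `w` -/

include hd hT₂ hDD hQm hf hF'' in
/-- **THE SHORT-ROOT `SL₂` RELATION OF `F″` AT `w`, EVALUATED**: for `x ∈ E_wˣ`,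
`F″(φ(P_w) φ(u₋(1_w x)) g) = χ⁰_w(−1) · chiNorm_w(x)⁻¹ · |x|_w^{−(2s₀+1)} · F″(φ(P_w) φ(u₋(1_w x⁻¹)) φ(P_w) g)` — ★ B7-B `apply_partialWeyl_uMinus_coord` with the torus law
of §1, valued by ★ B7-V `thetaA_placeUnit`: the `hrel` binder of ★ B7-S for the middle step (numerator `L_{E_w}(2s₀, χ⁰_F∘N)`).
[cite: HarrisKudlaSweet1996, §6 (6.16)] [cite: Casselman1980, §3 Thm. 3.1] -/
theorem hrel_short (w : PlacesOver E v) (A : GL (Fin 2) (UnitaryGroup.LocalRing E v))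
    (hA : A.val = !![1 - Pi.single w 1, Pi.single w 1; Pi.single w 1, 1 - Pi.single w 1])
    (x : (w.1.adicCompletion E)ˣ) (g : UnitaryGroup.localPi E c (2 + 2) J₂D v) :
    F'' (FrameTransport.frameConj F E c v (2 + 2) hJ₂D (antidiagonal_over_eq_map F E 2) Q hQ
          (toLocalFour F E c v (leviElt (UnitaryGroup.LocalRing E v) (UnitaryGroup.conjLocal E c v) (UnitaryGroup.conjLocal_conjLocal c v hcδ hδ) A)) *
        FrameTransport.frameConj F E c v (2 + 2) hJ₂D (antidiagonal_over_eq_map F E 2) Q hQ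
          (toLocalFour F E c v (uMinus (UnitaryGroup.LocalRing E v) (UnitaryGroup.conjLocal E c v) (UnitaryGroup.conjLocal_conjLocal c v hcδ hδ) (Pi.single w (x : w.1.adicCompletion E)))) * g) =
      ((χv₀ w (-1) : ℂˣ) : ℂ) * (((chiNorm F E c v χv₀ w x)⁻¹ : ℂˣ) : ℂ) *
          ((normAbs (w.1.adicCompletion E) (x : w.1.adicCompletion E) : ℝ) : ℂ) ^ (-(2 * s₀ + 1)) *
        F'' (FrameTransport.frameConj F E c v (2 + 2) hJ₂D (antidiagonal_over_eq_map F E 2) Q hQ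
              (toLocalFour F E c v (leviElt (UnitaryGroup.LocalRing E v) (UnitaryGroup.conjLocal E c v) (UnitaryGroup.conjLocal_conjLocal c v hcδ hδ) A)) *
            FrameTransport.frameConj F E c v (2 + 2) hJ₂D (antidiagonal_over_eq_map F E 2) Q hQ
              (toLocalFour F E c v (uMinus (UnitaryGroup.LocalRing E v) (UnitaryGroup.conjLocal E c v) (UnitaryGroup.conjLocal_conjLocal c v hcδ hδ)
                (Pi.single w ((x⁻¹ : (w.1.adicCompletion E)ˣ) : w.1.adicCompletion E)))) *
            FrameTransport.frameConj F E c v (2 + 2) hJ₂D (antidiagonal_over_eq_map F E 2) Q hQ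
              (toLocalFour F E c v (leviElt (UnitaryGroup.LocalRing E v) (UnitaryGroup.conjLocal E c v) (UnitaryGroup.conjLocal_conjLocal c v hcδ hδ) A)) * g) := by
  rw [apply_partialWeyl_uMinus_coord F E c hcδ hδ v hJ₂D Q hQ w F'' _ A hA (apply_uMinus F E c hcδ hδ hd v hT₂ hJ₂D D Dinv hDD Q hQm hQ μF χv₀ s₀ hf κ hF'')
    (apply_torusElt F E c hcδ hδ hd v hT₂ hJ₂D D Dinv hDD Q hQm hQ μF χv₀ s₀ hf κ hF'') x g,
    thetaA_placeUnit F E c hcδ hδ hd v hT₂ hJ₂D D Dinv hDD Q hQm hQ w χv₀ s₀ x]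


/-! ## §3 The second short-root stage (split places `w₁ ≠ w₂`): structure of `F₃ = κ′ · ℬ_{w₂} F″` and its `hrel` at `w₁` -/

section Second

variable (w₂ : PlacesOver E v) [MeasurableSpace (w₂.1.adicCompletion E)] [BorelSpace (w₂.1.adicCompletion E)] (μ₂ : Measure (w₂.1.adicCompletion E)) [μ₂.IsAddHaarMeasure]
  (A₂ : GL (Fin 2) (UnitaryGroup.LocalRing E v)) (hA₂ : A₂.val = !![1 - Pi.single w₂ 1, Pi.single w₂ 1; Pi.single w₂ 1, 1 - Pi.single w₂ 1])
  (κ' : ℂ) {F₃ : UnitaryGroup.localPi E c (2 + 2) J₂D v → ℂ}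
  (hF₃ : ∀ g, F₃ g = κ' * ∫ ζ, F'' (FrameTransport.frameConj F E c v (2 + 2) hJ₂D (antidiagonal_over_eq_map F E 2) Q hQ
      (toLocalFour F E c v (leviElt (UnitaryGroup.LocalRing E v) (UnitaryGroup.conjLocal E c v) (UnitaryGroup.conjLocal_conjLocal c v hcδ hδ) A₂)) *
    FrameTransport.frameConj F E c v (2 + 2) hJ₂D (antidiagonal_over_eq_map F E 2) Q hQ
      (toLocalFour F E c v (uMinus (UnitaryGroup.LocalRing E v) (UnitaryGroup.conjLocal E c v) (UnitaryGroup.conjLocal_conjLocal c v hcδ hδ) (Pi.single w₂ ζ))) * g) ∂μ₂)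

omit [BorelSpace (v.adicCompletion F)] [μF.IsAddHaarMeasure] in
include hd hT₂ hDD hQm hf hF'' hA₂ hF₃ in
/-- **`F₃` is invariant under every Levi root letter `φ(u₋(r))`**: at `w₂` by translation of the root variable, at `w′ ≠ w₂` through `F″` (★ B7-B §2).
[cite: HarrisKudlaSweet1996, §6 (6.16)] -/
theorem apply_uMinus₂ (r : UnitaryGroup.LocalRing E v) (g : UnitaryGroup.localPi E c (2 + 2) J₂D v) :
    F₃ (FrameTransport.frameConj F E c v (2 + 2) hJ₂D (antidiagonal_over_eq_map F E 2) Q hQ (toLocalFour F E c v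
      (uMinus (UnitaryGroup.LocalRing E v) (UnitaryGroup.conjLocal E c v) (UnitaryGroup.conjLocal_conjLocal c v hcδ hδ) r)) * g) = F₃ g := by
  refine apply_uMinus_of_forall_single F E c hcδ hδ v hJ₂D Q hQ F₃ (fun w' b g => ?_) r g
  rw [hF₃, hF₃]
  by_cases hw : w' = w₂
  · subst hw
    rw [stageShort_apply_uMinus_single F E c hcδ hδ v hJ₂D Q hQ w' μ₂ F'' A₂]
  · rw [stageShort_apply_uMinus_single_of_ne F E c hcδ hδ v hJ₂D Q hQ w₂ μ₂ F'' A₂ hA₂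
      (apply_uMinus F E c hcδ hδ hd v hT₂ hJ₂D D Dinv hDD Q hQm hQ μF χv₀ s₀ hf κ hF'') (Ne.symm hw)]

omit [BorelSpace (w₂.1.adicCompletion E)] [μ₂.IsAddHaarMeasure] in
include hd hT₂ hDD hQm hf hF'' hF₃ in
/-- **`F₃` is invariant under every block letter `φ(n(X))`** (★ B7-B `stageShort_apply_nSiegelBlk` on §1). [cite: HarrisKudlaSweet1996, §1 (1.11)] -/
theorem apply_nSiegelBlk₂ (X : Matrix (Fin 2) (Fin 2) (UnitaryGroup.LocalRing E v)) (hX : IsSkewTwo (UnitaryGroup.LocalRing E v) (UnitaryGroup.conjLocal E c v) X)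
    (g : UnitaryGroup.localPi E c (2 + 2) J₂D v) :
    F₃ (FrameTransport.frameConj F E c v (2 + 2) hJ₂D (antidiagonal_over_eq_map F E 2) Q hQ (toLocalFour F E c v
      (nSiegelBlk (UnitaryGroup.LocalRing E v) (UnitaryGroup.conjLocal E c v) hX)) * g) = F₃ g := by
  rw [hF₃, hF₃, stageShort_apply_nSiegelBlk F E c hcδ hδ v hJ₂D Q hQ w₂ μ₂ F'' A₂
    (apply_nSiegelBlk F E c hcδ hδ hd v hT₂ hJ₂D D Dinv hDD Q hQm hQ μF χv₀ s₀ hf κ hF'')]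

include hd hT₂ hDD hQm hf hF'' hA₂ hF₃ in
/-- **the torus law of `F₃`**: the `w₂`-swap of `θ_𝒜` with the Jacobian `‖a_{w₂}‖ ‖b_{w₂}‖⁻¹` (★ B7-B `stageShort_apply_torusElt` on §1). [cite: Casselman1980, §3] -/
theorem apply_torusElt₂ (a b : (UnitaryGroup.LocalRing E v)ˣ) (g : UnitaryGroup.localPi E c (2 + 2) J₂D v) :
    F₃ (FrameTransport.frameConj F E c v (2 + 2) hJ₂D (antidiagonal_over_eq_map F E 2) Q hQ (toLocalFour F E c v
      (torusElt (UnitaryGroup.LocalRing E v) (UnitaryGroup.conjLocal E c v) (UnitaryGroup.conjLocal_conjLocal c v hcδ hδ) a b)) * g) =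
      (fun a' b' : (UnitaryGroup.LocalRing E v)ˣ =>
          localSiegelCharacter F E c v 2 χv₀ s₀ (FrameTransport.frameConj F E c v (2 + 2) hJ₂D (antidiagonal_over_eq_map F E 2) Q hQ (toLocalFour F E c v
              (torusElt (UnitaryGroup.LocalRing E v) (UnitaryGroup.conjLocal E c v) (UnitaryGroup.conjLocal_conjLocal c v hcδ hδ) a'
                (Units.map (UnitaryGroup.conjLocal E c v : UnitaryGroup.LocalRing E v →* UnitaryGroup.LocalRing E v) b'⁻¹)))) *
            ((∏ w : PlacesOver E v, ‖(b' : UnitaryGroup.LocalRing E v) w‖ : ℝ) : ℂ))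
        (a * (Units.map (MonoidHom.mulSingle (fun w' : PlacesOver E v => w'.1.adicCompletion E) w₂)
              (Units.map (Pi.evalMonoidHom (fun w' : PlacesOver E v => w'.1.adicCompletion E) w₂) a))⁻¹ *
            Units.map (MonoidHom.mulSingle (fun w' : PlacesOver E v => w'.1.adicCompletion E) w₂)
              (Units.map (Pi.evalMonoidHom (fun w' : PlacesOver E v => w'.1.adicCompletion E) w₂) b))
        (b * (Units.map (MonoidHom.mulSingle (fun w' : PlacesOver E v => w'.1.adicCompletion E) w₂)
              (Units.map (Pi.evalMonoidHom (fun w' : PlacesOver E v => w'.1.adicCompletion E) w₂) b))⁻¹ *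
            Units.map (MonoidHom.mulSingle (fun w' : PlacesOver E v => w'.1.adicCompletion E) w₂)
              (Units.map (Pi.evalMonoidHom (fun w' : PlacesOver E v => w'.1.adicCompletion E) w₂) a)) *
        ((‖(a : UnitaryGroup.LocalRing E v) w₂‖ * ‖(b : UnitaryGroup.LocalRing E v) w₂‖⁻¹ : ℝ) : ℂ) * F₃ g := by
  rw [hF₃, hF₃, stageShort_apply_torusElt F E c hcδ hδ v hJ₂D Q hQ w₂ μ₂ F'' _ A₂ hA₂
    (apply_torusElt F E c hcδ hδ hd v hT₂ hJ₂D D Dinv hDD Q hQm hQ μF χv₀ s₀ hf κ hF'')]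
  ring

include hd hT₂ hDD hQm hf hF'' hA₂ hF₃ in
/-- **THE SHORT-ROOT `SL₂` RELATION OF `F₃` AT THE OTHER PLACE `w₁ ≠ w₂`, EVALUATED** — same datum `(χ⁰_{w₁}(−1), chiNorm_{w₁}, 2s₀ + 1)`: the `w₂`-swap is
trivial on `w₁`-supported units (★ B7-V `placeUnit_eval_placeUnit_of_ne`) and the Jacobian is `1`. [cite: HarrisKudlaSweet1996, §6 (6.16)] [cite: Casselman1980, §3 Thm. 3.1] -/
theorem hrel_short₂ (w₁ : PlacesOver E v) (hw : w₁ ≠ w₂) (A₁ : GL (Fin 2) (UnitaryGroup.LocalRing E v))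
    (hA₁ : A₁.val = !![1 - Pi.single w₁ 1, Pi.single w₁ 1; Pi.single w₁ 1, 1 - Pi.single w₁ 1])
    (x : (w₁.1.adicCompletion E)ˣ) (g : UnitaryGroup.localPi E c (2 + 2) J₂D v) :
    F₃ (FrameTransport.frameConj F E c v (2 + 2) hJ₂D (antidiagonal_over_eq_map F E 2) Q hQ
          (toLocalFour F E c v (leviElt (UnitaryGroup.LocalRing E v) (UnitaryGroup.conjLocal E c v) (UnitaryGroup.conjLocal_conjLocal c v hcδ hδ) A₁)) *
        FrameTransport.frameConj F E c v (2 + 2) hJ₂D (antidiagonal_over_eq_map F E 2) Q hQ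
          (toLocalFour F E c v (uMinus (UnitaryGroup.LocalRing E v) (UnitaryGroup.conjLocal E c v) (UnitaryGroup.conjLocal_conjLocal c v hcδ hδ) (Pi.single w₁ (x : w₁.1.adicCompletion E)))) * g) =
      ((χv₀ w₁ (-1) : ℂˣ) : ℂ) * (((chiNorm F E c v χv₀ w₁ x)⁻¹ : ℂˣ) : ℂ) *
          ((normAbs (w₁.1.adicCompletion E) (x : w₁.1.adicCompletion E) : ℝ) : ℂ) ^ (-(2 * s₀ + 1)) *
        F₃ (FrameTransport.frameConj F E c v (2 + 2) hJ₂D (antidiagonal_over_eq_map F E 2) Q hQ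
              (toLocalFour F E c v (leviElt (UnitaryGroup.LocalRing E v) (UnitaryGroup.conjLocal E c v) (UnitaryGroup.conjLocal_conjLocal c v hcδ hδ) A₁)) *
            FrameTransport.frameConj F E c v (2 + 2) hJ₂D (antidiagonal_over_eq_map F E 2) Q hQ
              (toLocalFour F E c v (uMinus (UnitaryGroup.LocalRing E v) (UnitaryGroup.conjLocal E c v) (UnitaryGroup.conjLocal_conjLocal c v hcδ hδ)
                (Pi.single w₁ ((x⁻¹ : (w₁.1.adicCompletion E)ˣ) : w₁.1.adicCompletion E)))) *
            FrameTransport.frameConj F E c v (2 + 2) hJ₂D (antidiagonal_over_eq_map F E 2) Q hQ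
              (toLocalFour F E c v (leviElt (UnitaryGroup.LocalRing E v) (UnitaryGroup.conjLocal E c v) (UnitaryGroup.conjLocal_conjLocal c v hcδ hδ) A₁)) * g) := by
  rw [apply_partialWeyl_uMinus_coord F E c hcδ hδ v hJ₂D Q hQ w₁ F₃ _ A₁ hA₁
    (apply_uMinus₂ F E c hcδ hδ hd v hT₂ hJ₂D D Dinv hDD Q hQm hQ μF χv₀ s₀ hf κ hF'' w₂ μ₂ A₂ hA₂ κ' hF₃)
    (apply_torusElt₂ F E c hcδ hδ hd v hT₂ hJ₂D D Dinv hDD Q hQm hQ μF χv₀ s₀ hf κ hF'' w₂ μ₂ A₂ hA₂ κ' hF₃) x g]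
  have h1 : ((Units.map (MonoidHom.mulSingle (fun w' : PlacesOver E v => w'.1.adicCompletion E) w₁) (-x⁻¹) : (UnitaryGroup.LocalRing E v)ˣ) :
      UnitaryGroup.LocalRing E v) w₂ = 1 := by rw [val_placeUnit, Pi.mulSingle_eq_of_ne (Ne.symm hw)]
  have h2 : ((Units.map (MonoidHom.mulSingle (fun w' : PlacesOver E v => w'.1.adicCompletion E) w₁) x : (UnitaryGroup.LocalRing E v)ˣ) :
      UnitaryGroup.LocalRing E v) w₂ = 1 := by rw [val_placeUnit, Pi.mulSingle_eq_of_ne (Ne.symm hw)]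
  simp only [placeUnit_eval_placeUnit_of_ne F E v (Ne.symm hw), inv_one, mul_one, h1, h2, norm_one, Complex.ofReal_one]
  rw [thetaA_placeUnit F E c hcδ hδ hd v hT₂ hJ₂D D Dinv hDD Q hQm hQ w₁ χv₀ s₀ x]

end Second

end Summit.HodgeConjecture.HodgeConjecture.Cruxes.HLiu418.K2LiuSiegelCocycleChainShort

end
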